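import Mathlib
import HarnessLib
import Summits.NavierStokesRegularity.NavierStokesRegularity.Theses.PoloidalWindowDoor
import Summits.NavierStokesRegularity.NavierStokesRegularity.Theorems.PoloidalWindowDoorPoloidalWindowRigiditySharper
import Summits.NavierStokesRegularity.NavierStokesRegularity.Theorems.PoloidalWindowDoorPoloidalWindowRigidityK2OfLrcSpatial
import Summits.NavierStokesRegularity.NavierStokesRegularity.Theorems.PoloidalWindowDoorPoloidalWindowRigidityHorizontalFlatPast
import Summits.NavierStokesRegularity.NavierStokesRegularity.Theorems.PoloidalWindowDoorPoloidalWindowRigidityEntireGerm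
import Summits.NavierStokesRegularity.NavierStokesRegularity.Theorems.PoloidalWindowDoorPoloidalWindowRigidityTimeShearLiminf
import Summits.NavierStokesRegularity.NavierStokesRegularity.Theorems.PoloidalWindowDoorPoloidalWindowRigidityK2OfLrcSlope
import Summits.NavierStokesRegularity.NavierStokesRegularity.Theorems.PoloidalWindowDoorPoloidalWindowRigidityStubUntwisted
import Summits.NavierStokesRegularity.NavierStokesRegularity.Theorems.PoloidalWindowDoorPoloidalWindowRigidityThmAThreeStubs
import Summits.NavierStokesRegularity.NavierStokesRegularity.Theorems.PoloidalWindowDoorPoloidalWindowRigidityThickStubsOfLocalEmpty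
import Literature.Analysis.FluidPDE.OseenMildUniqueness
import Literature.Analysis.FluidPDE.OseenZoomCovariance
import Summits.NavierStokesRegularity.NavierStokesRegularity.Theorems.PoloidalWindowDoorPoloidalWindowRigidityCongruenceDoor
import Summits.NavierStokesRegularity.NavierStokesRegularity.Theorems.LocalSineTubeDoorProfileAlignedWindowRigidityAncient

/-!
# Line `killing_door` for crux K2 `PoloidalWindowRigidity` (stmt-NavierStokesRegularity-19708) — crux-strategist g7

**What this is.**  A registered skeleton line for the crux: FOUR named sorried stubs — one KINEMATIC lemma (K0, true and
M-sized: pure calculus, no Navier–Stokes) and three research residues R1–R3 — plus the kernel-checked composition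
`PoloidalWindowRigidity_of_killingDoor` concluding the crux BY NAME.  WHAT THIS IS NOT: a proof of `PoloidalWindowRigidity`,
of the route, or of Navier–Stokes regularity.  **NS regularity is not proved by this.**

**Thesis (the KILLING DOOR = the congruence door in Lie-algebra form).**  `congruence_door` (g4) proved the DOOR
«two CONGRUENT slices ⇒ regular» (G0, tree theorem `…Theorems.PoloidalWindowDoorPoloidalWindowRigidityCongruenceDoor.stub_congruenceDoor`,
p588922) and left residues G1–G3 = «the twisting strata have two congruent slices».  But the engines that attack the residue
(cert-1 / K2-p3 jet elimination, nsreg-p7 g12 RESULT 2/4: the only consistent twisting (TH) jet strata found are STEADY / a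
relative equilibrium `V₀`) speak in LOCAL DIFFERENTIAL IDENTITIES on one open space–time set, never in finite congruences of two
whole slices; g4's card itself asked to «adjoin the infinitesimal version `∂ₜu = (c + Ωe₃×x)·∇u − Ωe₃×u`» — and no theorem in
the tree cashes such a certificate.  This line supplies exactly that theorem shape:

* **K0, RIGID-MOTION KINEMATICS** (`stub_rigidMotionKinematics`; TRUE, M-sized, NS-free): if `v` is real-analytic on the
  backward slab and satisfies, on SOME nonempty open space–time set, the relative-equilibrium identity
  `∂ₜv + Dv·(c + Sx) − Sv = 0` for a constant vector `c` and a constant SKEW operator `S` (an infinitesimal Euclidean motion =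
  Killing field `ξ = c + Sx`), then two slices `s < t < 0` are congruent by a Euclidean motion on an open set (indeed
  `v(t, y) = e^{(t−s)S} v(s, g⁻¹ y)` for all `y`, `g` the time-`(t−s)` flow of `ξ`).  Proof plan: identity theorem on the
  connected slab (the defect is analytic) ⇒ the identity holds on the whole slab; along the screw motion
  `g_τ x = e^{τS}x + ∫₀^τ e^{σS}c dσ` the curve `y(τ) = v(τ, g_τ x)` solves the linear ODE `y′ = S y` (chain rule), so
  `y(t) = e^{(t−s)S} y(s)`; `e^{(t−s)S}` is a linear isometry because `S` is skew (`NormedSpace.exp` of a skew-adjoint operator,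
  Mathlib `LinearIsometryEquiv` from `unitary`/orthogonality of `exp`), which is G0's hypothesis with `A = e^{(t−s)S}`,
  `b = g_{t−s} 0`.
* **the KILLING DOOR** (`killingDoor`, PROVED here = tree G0 ∘ K0 ∘ `…Ancient.analyticOnNhd_uncurry`): a profile of the route's
  Type-I ancient mild class that is a relative equilibrium on some open space–time set is not backward-singular at the apex.
  Covers steady, travelling-wave, rotating-wave and helical/screw-wave germs — the whole contingency (II) «steady stratum `V₀`»
  of nsreg-p7 g12 — in the currency a jet computation can certify (4 + 3 unknown CONSTANTS `c, S` adjoined to the hierarchy).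
* **R1–R3, LOCAL RIGIDITY OF THE TWISTING STRATA** (`stub_rigidHyperbolicTH`, `stub_rigidHyperbolicThick`,
  `stub_rigidSemiEllipticThick`): VERBATIM the hypotheses of `mixed_type` v2's three stubs (= congruence_door G1–G3 binders:
  class + (M) + poloidal + non-degenerate twisting window with the (TV)-pin, split by TYPE and by (TH)/THICK), conclusion
  «`v` is a relative equilibrium on some nonempty open subset of the slab».  STRICTLY SMALLER than `stub_twisting` / the
  mixed_type stubs (conclusion is a first-order structural identity, not regularity) and — modulo the true lemma K0 —
  than G1–G3 (infinitesimal rigidity on an open set ⇒ congruent slices by K0; the converse fails: two congruent slices do not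
  make a field a relative equilibrium).  They are closed BY NAME by every currency already in play: the local emptiness
  certificates `hemptyHypNF` (twist_split v4.2) / `hempty_thick` make their hypotheses inconsistent (closers for R2/R3 proved
  at the end of this file, four lines each, as in `mixed_type` v2; R1 ⇐ `hemptyHypNF` is p589072's argument with the
  conclusion irrelevant), AND by the weaker STEADY-STRATUM certificates («every consistent twisting (TH) jet is a relative
  equilibrium») that contingency (II) calls for — which close NO other registered line.

**Composition (all `theorem`s below are kernel-checked; sorries only in the four `stub_*`).**
K0 + tree G0 ⇒ `killingDoor`; `killingDoor` + R1/R2/R3 ⇒ the three `mixed_type` v2 stubs VERBATIM (`hyperbolicTH_of_killing`,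
`hyperbolicThick_of_killing`, `semiEllipticThick_of_killing`) ⇒ `lrc_jet` v5 `stub_twisting` VERBATIM (`twisting_of_killing`, by
the tree theorem `…ThmAThreeStubs.twisting_regular_of_three`, p581287) ⇒ with the tree theorem `untwisted_tree`
(= `…StubUntwisted.stub_untwisted`, p561151) the twist dichotomy `ndRegular` ⇒ `lrcSpatial_of_stubs` ⇒ (`tvLiminf_tree`, p525351)
`sliceSharpNonflatLiouville_of_killingDoor` ⇒ (`…Sharper.poloidalWindowRigidity_of_sliceSharpNonflatLiouville`)
`PoloidalWindowRigidity_of_killingDoor : …Theses.PoloidalWindowDoor.PoloidalWindowRigidity`.  Layer 2 onward is VERBATIM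
`Lines/congruence_door.lean` (g4), itself verbatim `Lines/mixed_type.lean` v2.

**Disproof class honoured.**  Every research stub keeps (M) (Oseen-mild) and Type-I among its binders: refuter1's
`…Negative.poloidalWindowRigidity_false_without_mild`, `twisting(TH|Thick)_false_without_mild`, K-50/K-52
`(hyperbolic|semiElliptic)Thick_false_without_mild` and p594673's `G1/G2/G3 _false_without_mild` all use (M)-free Type-I
profiles of the form `V(x)/√(−t)` or frozen kinematic profiles; a profile `V(x)/√(−t)` with `V ≢ 0` is a relative equilibrium on
NO open set (the defect `DV·ξ − SV = −V/(2(−t))` has a time-dependent right side), so the same witnesses refute R1–R3 minus (M):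
(M) is load-bearing and kept.  K0 is NS-free and true as stated (its hypothesis is analyticity, which the composition derives
from (M) via `…Ancient.analyticOnNhd_uncurry`).  K2-p4's `local*_false_without_momentum` concern local germ statements; R1–R3
are class-level and keep the full momentum equation through (M).
-/

-- the summit and its single sub-problem share the name (CONVENTIONS §1)
set_option linter.dupNamespace false

namespace Summit.NavierStokesRegularity.NavierStokesRegularity.Cruxes.PoloidalWindowRigidity.KillingDoor

open Set Function
open scoped RealInnerProductSpace InnerProductSpace
open Literature.Analysis Literature.Analysis.FluidPDE
open Summit.NavierStokesRegularity.NavierStokesRegularity.Theorems.PoloidalWindowDoorPoloidalWindowRigiditySharper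
open Summit.NavierStokesRegularity.NavierStokesRegularity.Theorems.PoloidalWindowDoorPoloidalWindowRigidityK2OfLrcSpatial
open Summit.NavierStokesRegularity.NavierStokesRegularity.Theorems.PoloidalWindowDoorPoloidalWindowRigidityHorizontalFlatPast
open Summit.NavierStokesRegularity.NavierStokesRegularity.Theorems.PoloidalWindowDoorPoloidalWindowRigidityEntireGerm
open Summit.NavierStokesRegularity.NavierStokesRegularity.Theorems.PoloidalWindowDoorPoloidalWindowRigidityK2OfLrcSlope
open Summit.NavierStokesRegularity.NavierStokesRegularity.Theorems.TubeAlternative.AnalyticPropagation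
open Summit.NavierStokesRegularity.NavierStokesRegularity.Theorems.PoloidalWindowDoorPoloidalWindowRigidityThmAThreeStubs

/-! ### The four registered stubs -/

/-- **STUB K0 — RIGID-MOTION KINEMATICS (true lemma, M-sized, no Navier–Stokes).**  A field `v : ℝ → ℝ³ → ℝ³` real-analytic
on the backward slab `(−∞,0) × ℝ³` which, on some nonempty open space–time set `W₁` of the slab, is a RELATIVE EQUILIBRIUM —
`∂ₜv(τ,x) + Dv(τ,x)·(c + Sx) − S v(τ,x) = 0` for a constant vector `c` and a constant skew operator `S` (the infinitesimal
Euclidean motion / Killing field `ξ(x) = c + Sx`) — has two slices `s < t < 0` congruent by a Euclidean motion on a nonempty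
open set (the hypothesis of the congruence door G0, VERBATIM).  Plan: (1) the defect
`z ↦ ∂ₜv + Dv·ξ − Sv` is analytic on the (connected, open) slab and vanishes on `W₁`, so it vanishes on the slab
(`AnalyticOnNhd.eqOn_zero_of_preconnected_of_eventuallyEq_zero`); (2) with `g_τ x = exp(τS) x + ∫₀^τ exp(σS) c dσ` (so
`∂_τ g_τ x = ξ(g_τ x)`), the curve `y(τ) = v(τ, g_τ x)` satisfies `y′ = S y` by the chain rule, hence
`y(t) = exp((t−s)S) y(s)` (uniqueness for the linear ODE, or `d/dτ (exp(−τS) y) = 0`); (3) `S` skew ⇒ `A := exp((t−s)S)` is a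
linear isometry (`⟪Sx,x⟫ = 0` ⇒ `‖exp(τS)x‖` constant), and `x ↦ g_{t−s} x = A x + b` is onto, so
`v t y = A (v s (A.symm (y − b)))` for every `y` (take `O = univ`). [folklore: travelling / rotating waves are steady in the
co-moving frame] -/
theorem stub_rigidMotionKinematics :
    ∀ (v : ℝ → EuclideanSpace ℝ (Fin 3) → EuclideanSpace ℝ (Fin 3)),
      AnalyticOnNhd ℝ (Function.uncurry v) (Set.Iio (0 : ℝ) ×ˢ Set.univ) →
      (∃ W₁ : Set (ℝ × EuclideanSpace ℝ (Fin 3)), IsOpen W₁ ∧ W₁.Nonempty ∧ W₁ ⊆ Set.Iio (0 : ℝ) ×ˢ Set.univ ∧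
          ∃ (c : EuclideanSpace ℝ (Fin 3)) (S : EuclideanSpace ℝ (Fin 3) →L[ℝ] EuclideanSpace ℝ (Fin 3)),
            (∀ x y : EuclideanSpace ℝ (Fin 3), ⟪S x, y⟫_ℝ = -⟪x, S y⟫_ℝ) ∧
            ∀ z ∈ W₁, deriv (fun τ => v τ z.2) z.1 + fderiv ℝ (v z.1) z.2 (c + S z.2) - S (v z.1 z.2) = 0) →
      ∃ s t : ℝ, s < t ∧ t < 0 ∧
        ∃ (A : EuclideanSpace ℝ (Fin 3) ≃ₗᵢ[ℝ] EuclideanSpace ℝ (Fin 3)) (b : EuclideanSpace ℝ (Fin 3))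
          (O : Set (EuclideanSpace ℝ (Fin 3))), IsOpen O ∧ O.Nonempty ∧ ∀ x ∈ O, v t x = A (v s (A.symm (x - b))) := by
  sorry

/-- **STUB R1 — LOCAL RIGIDITY OF THE HYPERBOLIC (TH) TWISTING STRATUM (research residue, re-typed in certificate currency).**
VERBATIM the hypotheses of `mixed_type` v2's `stub_hyperbolicTH` (= congruence_door G1: class + (M), poloidal along `e₃`, a
nonempty open window `W` of the backward slab which is non-degenerate, carries the (TV)-pin «the shear slope is a function of
`t` alone on no open sub-window», is TWISTING, HYPERBOLIC `∂₂v₀·∂₀v₂ + ∂₂v₁·∂₁v₂ < 0` and (TH) «slope a function of `(t,x₂)`»),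
conclusion: `v` is a RELATIVE EQUILIBRIUM on some nonempty open subset of the slab (`∂ₜv + Dv·(c+Sx) − Sv = 0`, `S` skew).
This is the statement a jet-elimination run on the (TH)∩twisting hierarchy would certify under contingency (II) of nsreg-p7
g12 («the consistent twisting stratum `V₀` is steady / a relative equilibrium»: adjoin the 6 unknown constants `c, S` and
eliminate), and it is implied outright by the emptiness certificate `hemptyHypNF` (twist_split v4.2 `stub_localTHEmptyHypNUG`,
whose hypotheses the present binders instantiate — p589072's four lines with the conclusion irrelevant).  What R1 excludes: a
GENUINELY UNSTEADY-modulo-motions twisting hyperbolic (TH) profile in the class; none is known (refuter1's genuinely unsteady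
crossed suction layers have time-only slope — excluded by the (TV)-pin; K2-p2's free-in-time (TH) families are untwisted).
(M) kept: `twistingTH_false_without_mild`; `V(x)/√(−t)` witnesses are rigid on no open set. -/
theorem stub_rigidHyperbolicTH :
    ∀ (C : ℝ) (v : ℝ → EuclideanSpace ℝ (Fin 3) → EuclideanSpace ℝ (Fin 3)),
      Literature.Analysis.FluidPDE.HasTypeITimeDecay C v →
      ContinuousOn (Function.uncurry v) (Set.Iio (0 : ℝ) ×ˢ Set.univ) →
      (∀ s t : ℝ, s < t → t < 0 → ∀ x, v t x =
        Literature.Analysis.UnboundedOperators.heatExtension (v s) (t - s) x -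
          Literature.Analysis.FluidPDE.oseenDuhamel 1 s v v t x) →
      (∀ t < 0, Literature.Analysis.FluidPDE.VectorCalculus.IsDivFree (v t)) →
      (∀ s < 0, ∀ y, ⟪Literature.Analysis.FluidPDE.curl (v s) y, EuclideanSpace.single 2 1⟫_ℝ = 0) →
      ∀ W : Set (ℝ × EuclideanSpace ℝ (Fin 3)), IsOpen W → W.Nonempty → W ⊆ Set.Iio (0 : ℝ) ×ˢ Set.univ →
        (∀ z ∈ W, Literature.Analysis.FluidPDE.curl (v z.1) z.2 ≠ 0 ∧
          (fderiv ℝ (v z.1) z.2 (EuclideanSpace.single 0 1) 2 ≠ 0 ∨ fderiv ℝ (v z.1) z.2 (EuclideanSpace.single 1 1) 2 ≠ 0) ∧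
          (fderiv ℝ (v z.1) z.2 (EuclideanSpace.single 2 1) 0 ≠ 0 ∨ fderiv ℝ (v z.1) z.2 (EuclideanSpace.single 2 1) 1 ≠ 0)) →
        (∀ m : ℝ → ℝ, ∀ W₁ : Set (ℝ × EuclideanSpace ℝ (Fin 3)), W₁ ⊆ W → IsOpen W₁ → W₁.Nonempty →
          ∃ z ∈ W₁, ∃ b : Fin 3, b ≠ 2 ∧
            fderiv ℝ (v z.1) z.2 (EuclideanSpace.single 2 1) b ≠
              m z.1 * fderiv ℝ (v z.1) z.2 (EuclideanSpace.single b 1) 2) →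
        (∀ z ∈ W,
          fderiv ℝ (fun x => fderiv ℝ (v z.1) x (EuclideanSpace.single 2 1) 2) z.2 (EuclideanSpace.single 0 1) *
              fderiv ℝ (v z.1) z.2 (EuclideanSpace.single 1 1) 2 -
            fderiv ℝ (fun x => fderiv ℝ (v z.1) x (EuclideanSpace.single 2 1) 2) z.2 (EuclideanSpace.single 1 1) *
              fderiv ℝ (v z.1) z.2 (EuclideanSpace.single 0 1) 2 ≠ 0) →
        (∀ z ∈ W,
          fderiv ℝ (v z.1) z.2 (EuclideanSpace.single 2 1) 0 * fderiv ℝ (v z.1) z.2 (EuclideanSpace.single 0 1) 2 +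
            fderiv ℝ (v z.1) z.2 (EuclideanSpace.single 2 1) 1 * fderiv ℝ (v z.1) z.2 (EuclideanSpace.single 1 1) 2 < 0) →
        (∃ m : ℝ → ℝ → ℝ, ∀ z ∈ W, ∀ b : Fin 3, b ≠ 2 →
          fderiv ℝ (v z.1) z.2 (EuclideanSpace.single 2 1) b =
            m z.1 (z.2 2) * fderiv ℝ (v z.1) z.2 (EuclideanSpace.single b 1) 2) →
        ∃ W₁ : Set (ℝ × EuclideanSpace ℝ (Fin 3)), IsOpen W₁ ∧ W₁.Nonempty ∧ W₁ ⊆ Set.Iio (0 : ℝ) ×ˢ Set.univ ∧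
          ∃ (c : EuclideanSpace ℝ (Fin 3)) (S : EuclideanSpace ℝ (Fin 3) →L[ℝ] EuclideanSpace ℝ (Fin 3)),
            (∀ x y : EuclideanSpace ℝ (Fin 3), ⟪S x, y⟫_ℝ = -⟪x, S y⟫_ℝ) ∧
            ∀ z ∈ W₁, deriv (fun τ => v τ z.2) z.1 + fderiv ℝ (v z.1) z.2 (c + S z.2) - S (v z.1 z.2) = 0 := by
  sorry

/-- **STUB R2 — LOCAL RIGIDITY OF THE HYPERBOLIC THICK TWISTING STRATUM (hardest stub).**  VERBATIM the hypotheses of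
`mixed_type` v2's `stub_hyperbolicThick` (as R1 but, instead of (TH), the THICKNESS clause: the slope is a function of `(t,x₂)`
on no open sub-window), conclusion «relative equilibrium on some nonempty open subset of the slab».  Implied by the thick
emptiness certificate `hempty_thick` (closer `rigidHyperbolicThick_of_localEmptyThick` below, proved); no thick poloidal NS
germ is known at all (K2-p5: helical / conical / oblique-2.5D classes numerically empty), and the only candidates ever
proposed (helical waves) are steady, translating or screw-rotating — relative equilibria.  (M) kept
(`hyperbolicThick_false_without_mild`, K-50). -/
theorem stub_rigidHyperbolicThick :
    ∀ (C : ℝ) (v : ℝ → EuclideanSpace ℝ (Fin 3) → EuclideanSpace ℝ (Fin 3)),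
      Literature.Analysis.FluidPDE.HasTypeITimeDecay C v →
      ContinuousOn (Function.uncurry v) (Set.Iio (0 : ℝ) ×ˢ Set.univ) →
      (∀ s t : ℝ, s < t → t < 0 → ∀ x, v t x =
        Literature.Analysis.UnboundedOperators.heatExtension (v s) (t - s) x -
          Literature.Analysis.FluidPDE.oseenDuhamel 1 s v v t x) →
      (∀ t < 0, Literature.Analysis.FluidPDE.VectorCalculus.IsDivFree (v t)) →
      (∀ s < 0, ∀ y, ⟪Literature.Analysis.FluidPDE.curl (v s) y, EuclideanSpace.single 2 1⟫_ℝ = 0) →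
      ∀ W : Set (ℝ × EuclideanSpace ℝ (Fin 3)), IsOpen W → W.Nonempty → W ⊆ Set.Iio (0 : ℝ) ×ˢ Set.univ →
        (∀ z ∈ W, Literature.Analysis.FluidPDE.curl (v z.1) z.2 ≠ 0 ∧
          (fderiv ℝ (v z.1) z.2 (EuclideanSpace.single 0 1) 2 ≠ 0 ∨ fderiv ℝ (v z.1) z.2 (EuclideanSpace.single 1 1) 2 ≠ 0) ∧
          (fderiv ℝ (v z.1) z.2 (EuclideanSpace.single 2 1) 0 ≠ 0 ∨ fderiv ℝ (v z.1) z.2 (EuclideanSpace.single 2 1) 1 ≠ 0)) →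
        (∀ m : ℝ → ℝ, ∀ W₁ : Set (ℝ × EuclideanSpace ℝ (Fin 3)), W₁ ⊆ W → IsOpen W₁ → W₁.Nonempty →
          ∃ z ∈ W₁, ∃ b : Fin 3, b ≠ 2 ∧
            fderiv ℝ (v z.1) z.2 (EuclideanSpace.single 2 1) b ≠
              m z.1 * fderiv ℝ (v z.1) z.2 (EuclideanSpace.single b 1) 2) →
        (∀ z ∈ W,
          fderiv ℝ (fun x => fderiv ℝ (v z.1) x (EuclideanSpace.single 2 1) 2) z.2 (EuclideanSpace.single 0 1) *
              fderiv ℝ (v z.1) z.2 (EuclideanSpace.single 1 1) 2 -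
            fderiv ℝ (fun x => fderiv ℝ (v z.1) x (EuclideanSpace.single 2 1) 2) z.2 (EuclideanSpace.single 1 1) *
              fderiv ℝ (v z.1) z.2 (EuclideanSpace.single 0 1) 2 ≠ 0) →
        (∀ z ∈ W,
          fderiv ℝ (v z.1) z.2 (EuclideanSpace.single 2 1) 0 * fderiv ℝ (v z.1) z.2 (EuclideanSpace.single 0 1) 2 +
            fderiv ℝ (v z.1) z.2 (EuclideanSpace.single 2 1) 1 * fderiv ℝ (v z.1) z.2 (EuclideanSpace.single 1 1) 2 < 0) →
        (∀ m : ℝ → ℝ → ℝ, ∀ W₁ : Set (ℝ × EuclideanSpace ℝ (Fin 3)), W₁ ⊆ W → IsOpen W₁ → W₁.Nonempty →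
          ∃ z ∈ W₁, ∃ b : Fin 3, b ≠ 2 ∧
            fderiv ℝ (v z.1) z.2 (EuclideanSpace.single 2 1) b ≠
              m z.1 (z.2 2) * fderiv ℝ (v z.1) z.2 (EuclideanSpace.single b 1) 2) →
        ∃ W₁ : Set (ℝ × EuclideanSpace ℝ (Fin 3)), IsOpen W₁ ∧ W₁.Nonempty ∧ W₁ ⊆ Set.Iio (0 : ℝ) ×ˢ Set.univ ∧
          ∃ (c : EuclideanSpace ℝ (Fin 3)) (S : EuclideanSpace ℝ (Fin 3) →L[ℝ] EuclideanSpace ℝ (Fin 3)),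
            (∀ x y : EuclideanSpace ℝ (Fin 3), ⟪S x, y⟫_ℝ = -⟪x, S y⟫_ℝ) ∧
            ∀ z ∈ W₁, deriv (fun τ => v τ z.2) z.1 + fderiv ℝ (v z.1) z.2 (c + S z.2) - S (v z.1 z.2) = 0 := by
  sorry

/-- **STUB R3 — LOCAL RIGIDITY OF THE SEMI-ELLIPTIC THICK TWISTING STRATUM.**  VERBATIM the hypotheses of `mixed_type` v2's
`stub_semiEllipticThick` (the window lies in a time band `(a,b)` on which the type scalar is `≥ 0` everywhere in space, plus
thickness), conclusion «relative equilibrium on some nonempty open subset of the slab».  Implied by `hempty_thick`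
(closer `rigidSemiEllipticThick_of_localEmptyThick` below, proved) — and, independently, `mixed_type`'s Theorem A
(`…ThmASemiEllipticThick.semiElliptic_regular_of_thick`, p580444) already settles the semi-elliptic thick column at the level of
regularity when the band is the whole slab; R3 is kept as a separate stub only because `twisting_regular_of_three` consumes the
three columns separately. (M) kept (`semiEllipticThick_false_without_mild`, K-52). -/
theorem stub_rigidSemiEllipticThick :
    ∀ (C : ℝ) (v : ℝ → EuclideanSpace ℝ (Fin 3) → EuclideanSpace ℝ (Fin 3)),
      Literature.Analysis.FluidPDE.HasTypeITimeDecay C v →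
      ContinuousOn (Function.uncurry v) (Set.Iio (0 : ℝ) ×ˢ Set.univ) →
      (∀ s t : ℝ, s < t → t < 0 → ∀ x, v t x =
        Literature.Analysis.UnboundedOperators.heatExtension (v s) (t - s) x -
          Literature.Analysis.FluidPDE.oseenDuhamel 1 s v v t x) →
      (∀ t < 0, Literature.Analysis.FluidPDE.VectorCalculus.IsDivFree (v t)) →
      (∀ s < 0, ∀ y, ⟪Literature.Analysis.FluidPDE.curl (v s) y, EuclideanSpace.single 2 1⟫_ℝ = 0) →
      ∀ W : Set (ℝ × EuclideanSpace ℝ (Fin 3)), IsOpen W → W.Nonempty → W ⊆ Set.Iio (0 : ℝ) ×ˢ Set.univ →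
        (∀ z ∈ W, Literature.Analysis.FluidPDE.curl (v z.1) z.2 ≠ 0 ∧
          (fderiv ℝ (v z.1) z.2 (EuclideanSpace.single 0 1) 2 ≠ 0 ∨ fderiv ℝ (v z.1) z.2 (EuclideanSpace.single 1 1) 2 ≠ 0) ∧
          (fderiv ℝ (v z.1) z.2 (EuclideanSpace.single 2 1) 0 ≠ 0 ∨ fderiv ℝ (v z.1) z.2 (EuclideanSpace.single 2 1) 1 ≠ 0)) →
        (∀ m : ℝ → ℝ, ∀ W₁ : Set (ℝ × EuclideanSpace ℝ (Fin 3)), W₁ ⊆ W → IsOpen W₁ → W₁.Nonempty →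
          ∃ z ∈ W₁, ∃ b : Fin 3, b ≠ 2 ∧
            fderiv ℝ (v z.1) z.2 (EuclideanSpace.single 2 1) b ≠
              m z.1 * fderiv ℝ (v z.1) z.2 (EuclideanSpace.single b 1) 2) →
        (∀ z ∈ W,
          fderiv ℝ (fun x => fderiv ℝ (v z.1) x (EuclideanSpace.single 2 1) 2) z.2 (EuclideanSpace.single 0 1) *
              fderiv ℝ (v z.1) z.2 (EuclideanSpace.single 1 1) 2 -
            fderiv ℝ (fun x => fderiv ℝ (v z.1) x (EuclideanSpace.single 2 1) 2) z.2 (EuclideanSpace.single 1 1) *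
              fderiv ℝ (v z.1) z.2 (EuclideanSpace.single 0 1) 2 ≠ 0) →
        ∀ a b : ℝ, W ⊆ Set.Ioo a b ×ˢ Set.univ →
          (∀ s ∈ Set.Ioo a b, ∀ y : EuclideanSpace ℝ (Fin 3),
            0 ≤ fderiv ℝ (v s) y (EuclideanSpace.single 2 1) 0 * fderiv ℝ (v s) y (EuclideanSpace.single 0 1) 2 +
              fderiv ℝ (v s) y (EuclideanSpace.single 2 1) 1 * fderiv ℝ (v s) y (EuclideanSpace.single 1 1) 2) →
        (∀ m : ℝ → ℝ → ℝ, ∀ W₁ : Set (ℝ × EuclideanSpace ℝ (Fin 3)), W₁ ⊆ W → IsOpen W₁ → W₁.Nonempty →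
          ∃ z ∈ W₁, ∃ b : Fin 3, b ≠ 2 ∧
            fderiv ℝ (v z.1) z.2 (EuclideanSpace.single 2 1) b ≠
              m z.1 (z.2 2) * fderiv ℝ (v z.1) z.2 (EuclideanSpace.single b 1) 2) →
        ∃ W₁ : Set (ℝ × EuclideanSpace ℝ (Fin 3)), IsOpen W₁ ∧ W₁.Nonempty ∧ W₁ ⊆ Set.Iio (0 : ℝ) ×ˢ Set.univ ∧
          ∃ (c : EuclideanSpace ℝ (Fin 3)) (S : EuclideanSpace ℝ (Fin 3) →L[ℝ] EuclideanSpace ℝ (Fin 3)),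
            (∀ x y : EuclideanSpace ℝ (Fin 3), ⟪S x, y⟫_ℝ = -⟪x, S y⟫_ℝ) ∧
            ∀ z ∈ W₁, deriv (fun τ => v τ z.2) z.1 + fderiv ℝ (v z.1) z.2 (c + S z.2) - S (v z.1 z.2) = 0 := by
  sorry

/-! ### The door (proved): K0 + the tree theorem G0 -/

/-- **THE KILLING DOOR (proved).**  A profile of the route's Type-I ancient mild class which is a relative equilibrium
(`∂ₜv + Dv·(c + Sx) − Sv = 0`, `S` skew, `c, S` constant) on some nonempty open space–time subset of the backward slab is not
backward-singular at the apex: joint analyticity of class profiles (`…Ancient.analyticOnNhd_uncurry`, from (M)) feeds K0, whose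
congruent slices feed the tree's congruence door `…CongruenceDoor.stub_congruenceDoor` (p588922). -/
theorem killingDoor :
    ∀ (C : ℝ) (v : ℝ → EuclideanSpace ℝ (Fin 3) → EuclideanSpace ℝ (Fin 3)),
      Literature.Analysis.FluidPDE.HasTypeITimeDecay C v →
      ContinuousOn (Function.uncurry v) (Set.Iio (0 : ℝ) ×ˢ Set.univ) →
      (∀ s t : ℝ, s < t → t < 0 → ∀ x, v t x =
        Literature.Analysis.UnboundedOperators.heatExtension (v s) (t - s) x -
          Literature.Analysis.FluidPDE.oseenDuhamel 1 s v v t x) →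
      (∃ W₁ : Set (ℝ × EuclideanSpace ℝ (Fin 3)), IsOpen W₁ ∧ W₁.Nonempty ∧ W₁ ⊆ Set.Iio (0 : ℝ) ×ˢ Set.univ ∧
          ∃ (c : EuclideanSpace ℝ (Fin 3)) (S : EuclideanSpace ℝ (Fin 3) →L[ℝ] EuclideanSpace ℝ (Fin 3)),
            (∀ x y : EuclideanSpace ℝ (Fin 3), ⟪S x, y⟫_ℝ = -⟪x, S y⟫_ℝ) ∧
            ∀ z ∈ W₁, deriv (fun τ => v τ z.2) z.1 + fderiv ℝ (v z.1) z.2 (c + S z.2) - S (v z.1 z.2) = 0) →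
      ¬ Literature.Analysis.FluidPDE.IsBackwardSingularPoint v 0 := by
  intro C v hrate hcont hmild hrigid
  have han : AnalyticOnNhd ℝ (Function.uncurry v) (Set.Iio (0 : ℝ) ×ˢ Set.univ) :=
    Summit.NavierStokesRegularity.NavierStokesRegularity.Theorems.LocalSineTubeDoorProfileAlignedWindowRigidityAncient.analyticOnNhd_uncurry
      hcont
      (Summit.NavierStokesRegularity.NavierStokesRegularity.Theorems.LocalSineTubeDoorProfileAlignedWindowRigidityAncient.bdd_of_hasTypeITimeDecay
        hrate)
      hmild
  exact
    Summit.NavierStokesRegularity.NavierStokesRegularity.Theorems.PoloidalWindowDoorPoloidalWindowRigidityCongruenceDoor.stub_congruenceDoor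
      C v hrate hcont hmild (stub_rigidMotionKinematics v han hrigid)

/-! ### Composition, layer 1 (proved): the three `mixed_type` v2 stubs from the Killing door and the three rigidity stubs -/

/-- `mixed_type` v2 `stub_hyperbolicTH`, VERBATIM, from the Killing door + R1. -/
theorem hyperbolicTH_of_killing :
    ∀ (C : ℝ) (v : ℝ → EuclideanSpace ℝ (Fin 3) → EuclideanSpace ℝ (Fin 3)),
      Literature.Analysis.FluidPDE.HasTypeITimeDecay C v →
      ContinuousOn (Function.uncurry v) (Set.Iio (0 : ℝ) ×ˢ Set.univ) →
      (∀ s t : ℝ, s < t → t < 0 → ∀ x, v t x =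
        Literature.Analysis.UnboundedOperators.heatExtension (v s) (t - s) x -
          Literature.Analysis.FluidPDE.oseenDuhamel 1 s v v t x) →
      (∀ t < 0, Literature.Analysis.FluidPDE.VectorCalculus.IsDivFree (v t)) →
      (∀ s < 0, ∀ y, ⟪Literature.Analysis.FluidPDE.curl (v s) y, EuclideanSpace.single 2 1⟫_ℝ = 0) →
      ∀ W : Set (ℝ × EuclideanSpace ℝ (Fin 3)), IsOpen W → W.Nonempty → W ⊆ Set.Iio (0 : ℝ) ×ˢ Set.univ →
        (∀ z ∈ W, Literature.Analysis.FluidPDE.curl (v z.1) z.2 ≠ 0 ∧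
          (fderiv ℝ (v z.1) z.2 (EuclideanSpace.single 0 1) 2 ≠ 0 ∨ fderiv ℝ (v z.1) z.2 (EuclideanSpace.single 1 1) 2 ≠ 0) ∧
          (fderiv ℝ (v z.1) z.2 (EuclideanSpace.single 2 1) 0 ≠ 0 ∨ fderiv ℝ (v z.1) z.2 (EuclideanSpace.single 2 1) 1 ≠ 0)) →
        (∀ m : ℝ → ℝ, ∀ W₁ : Set (ℝ × EuclideanSpace ℝ (Fin 3)), W₁ ⊆ W → IsOpen W₁ → W₁.Nonempty →
          ∃ z ∈ W₁, ∃ b : Fin 3, b ≠ 2 ∧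
            fderiv ℝ (v z.1) z.2 (EuclideanSpace.single 2 1) b ≠
              m z.1 * fderiv ℝ (v z.1) z.2 (EuclideanSpace.single b 1) 2) →
        (∀ z ∈ W,
          fderiv ℝ (fun x => fderiv ℝ (v z.1) x (EuclideanSpace.single 2 1) 2) z.2 (EuclideanSpace.single 0 1) *
              fderiv ℝ (v z.1) z.2 (EuclideanSpace.single 1 1) 2 -
            fderiv ℝ (fun x => fderiv ℝ (v z.1) x (EuclideanSpace.single 2 1) 2) z.2 (EuclideanSpace.single 1 1) *
              fderiv ℝ (v z.1) z.2 (EuclideanSpace.single 0 1) 2 ≠ 0) →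
        (∀ z ∈ W,
          fderiv ℝ (v z.1) z.2 (EuclideanSpace.single 2 1) 0 * fderiv ℝ (v z.1) z.2 (EuclideanSpace.single 0 1) 2 +
            fderiv ℝ (v z.1) z.2 (EuclideanSpace.single 2 1) 1 * fderiv ℝ (v z.1) z.2 (EuclideanSpace.single 1 1) 2 < 0) →
        (∃ m : ℝ → ℝ → ℝ, ∀ z ∈ W, ∀ b : Fin 3, b ≠ 2 →
          fderiv ℝ (v z.1) z.2 (EuclideanSpace.single 2 1) b =
            m z.1 (z.2 2) * fderiv ℝ (v z.1) z.2 (EuclideanSpace.single b 1) 2) →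
        ¬ Literature.Analysis.FluidPDE.IsBackwardSingularPoint v 0 := by
  intro C v hrate hcont hmild hdiv hpol W hW hWne hWs hnd hpin htw hhyp hTH
  exact killingDoor C v hrate hcont hmild
    (stub_rigidHyperbolicTH C v hrate hcont hmild hdiv hpol W hW hWne hWs hnd hpin htw hhyp hTH)

/-- `mixed_type` v2 `stub_hyperbolicThick`, VERBATIM, from the Killing door + R2. -/
theorem hyperbolicThick_of_killing :
    ∀ (C : ℝ) (v : ℝ → EuclideanSpace ℝ (Fin 3) → EuclideanSpace ℝ (Fin 3)),
      Literature.Analysis.FluidPDE.HasTypeITimeDecay C v →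
      ContinuousOn (Function.uncurry v) (Set.Iio (0 : ℝ) ×ˢ Set.univ) →
      (∀ s t : ℝ, s < t → t < 0 → ∀ x, v t x =
        Literature.Analysis.UnboundedOperators.heatExtension (v s) (t - s) x -
          Literature.Analysis.FluidPDE.oseenDuhamel 1 s v v t x) →
      (∀ t < 0, Literature.Analysis.FluidPDE.VectorCalculus.IsDivFree (v t)) →
      (∀ s < 0, ∀ y, ⟪Literature.Analysis.FluidPDE.curl (v s) y, EuclideanSpace.single 2 1⟫_ℝ = 0) →
      ∀ W : Set (ℝ × EuclideanSpace ℝ (Fin 3)), IsOpen W → W.Nonempty → W ⊆ Set.Iio (0 : ℝ) ×ˢ Set.univ →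
        (∀ z ∈ W, Literature.Analysis.FluidPDE.curl (v z.1) z.2 ≠ 0 ∧
          (fderiv ℝ (v z.1) z.2 (EuclideanSpace.single 0 1) 2 ≠ 0 ∨ fderiv ℝ (v z.1) z.2 (EuclideanSpace.single 1 1) 2 ≠ 0) ∧
          (fderiv ℝ (v z.1) z.2 (EuclideanSpace.single 2 1) 0 ≠ 0 ∨ fderiv ℝ (v z.1) z.2 (EuclideanSpace.single 2 1) 1 ≠ 0)) →
        (∀ m : ℝ → ℝ, ∀ W₁ : Set (ℝ × EuclideanSpace ℝ (Fin 3)), W₁ ⊆ W → IsOpen W₁ → W₁.Nonempty →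
          ∃ z ∈ W₁, ∃ b : Fin 3, b ≠ 2 ∧
            fderiv ℝ (v z.1) z.2 (EuclideanSpace.single 2 1) b ≠
              m z.1 * fderiv ℝ (v z.1) z.2 (EuclideanSpace.single b 1) 2) →
        (∀ z ∈ W,
          fderiv ℝ (fun x => fderiv ℝ (v z.1) x (EuclideanSpace.single 2 1) 2) z.2 (EuclideanSpace.single 0 1) *
              fderiv ℝ (v z.1) z.2 (EuclideanSpace.single 1 1) 2 -
            fderiv ℝ (fun x => fderiv ℝ (v z.1) x (EuclideanSpace.single 2 1) 2) z.2 (EuclideanSpace.single 1 1) *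
              fderiv ℝ (v z.1) z.2 (EuclideanSpace.single 0 1) 2 ≠ 0) →
        (∀ z ∈ W,
          fderiv ℝ (v z.1) z.2 (EuclideanSpace.single 2 1) 0 * fderiv ℝ (v z.1) z.2 (EuclideanSpace.single 0 1) 2 +
            fderiv ℝ (v z.1) z.2 (EuclideanSpace.single 2 1) 1 * fderiv ℝ (v z.1) z.2 (EuclideanSpace.single 1 1) 2 < 0) →
        (∀ m : ℝ → ℝ → ℝ, ∀ W₁ : Set (ℝ × EuclideanSpace ℝ (Fin 3)), W₁ ⊆ W → IsOpen W₁ → W₁.Nonempty →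
          ∃ z ∈ W₁, ∃ b : Fin 3, b ≠ 2 ∧
            fderiv ℝ (v z.1) z.2 (EuclideanSpace.single 2 1) b ≠
              m z.1 (z.2 2) * fderiv ℝ (v z.1) z.2 (EuclideanSpace.single b 1) 2) →
        ¬ Literature.Analysis.FluidPDE.IsBackwardSingularPoint v 0 := by
  intro C v hrate hcont hmild hdiv hpol W hW hWne hWs hnd hpin htw hhyp hthick
  exact killingDoor C v hrate hcont hmild
    (stub_rigidHyperbolicThick C v hrate hcont hmild hdiv hpol W hW hWne hWs hnd hpin htw hhyp hthick)

/-- `mixed_type` v2 `stub_semiEllipticThick`, VERBATIM, from the Killing door + R3. -/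
theorem semiEllipticThick_of_killing :
    ∀ (C : ℝ) (v : ℝ → EuclideanSpace ℝ (Fin 3) → EuclideanSpace ℝ (Fin 3)),
      Literature.Analysis.FluidPDE.HasTypeITimeDecay C v →
      ContinuousOn (Function.uncurry v) (Set.Iio (0 : ℝ) ×ˢ Set.univ) →
      (∀ s t : ℝ, s < t → t < 0 → ∀ x, v t x =
        Literature.Analysis.UnboundedOperators.heatExtension (v s) (t - s) x -
          Literature.Analysis.FluidPDE.oseenDuhamel 1 s v v t x) →
      (∀ t < 0, Literature.Analysis.FluidPDE.VectorCalculus.IsDivFree (v t)) →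
      (∀ s < 0, ∀ y, ⟪Literature.Analysis.FluidPDE.curl (v s) y, EuclideanSpace.single 2 1⟫_ℝ = 0) →
      ∀ W : Set (ℝ × EuclideanSpace ℝ (Fin 3)), IsOpen W → W.Nonempty → W ⊆ Set.Iio (0 : ℝ) ×ˢ Set.univ →
        (∀ z ∈ W, Literature.Analysis.FluidPDE.curl (v z.1) z.2 ≠ 0 ∧
          (fderiv ℝ (v z.1) z.2 (EuclideanSpace.single 0 1) 2 ≠ 0 ∨ fderiv ℝ (v z.1) z.2 (EuclideanSpace.single 1 1) 2 ≠ 0) ∧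
          (fderiv ℝ (v z.1) z.2 (EuclideanSpace.single 2 1) 0 ≠ 0 ∨ fderiv ℝ (v z.1) z.2 (EuclideanSpace.single 2 1) 1 ≠ 0)) →
        (∀ m : ℝ → ℝ, ∀ W₁ : Set (ℝ × EuclideanSpace ℝ (Fin 3)), W₁ ⊆ W → IsOpen W₁ → W₁.Nonempty →
          ∃ z ∈ W₁, ∃ b : Fin 3, b ≠ 2 ∧
            fderiv ℝ (v z.1) z.2 (EuclideanSpace.single 2 1) b ≠
              m z.1 * fderiv ℝ (v z.1) z.2 (EuclideanSpace.single b 1) 2) →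
        (∀ z ∈ W,
          fderiv ℝ (fun x => fderiv ℝ (v z.1) x (EuclideanSpace.single 2 1) 2) z.2 (EuclideanSpace.single 0 1) *
              fderiv ℝ (v z.1) z.2 (EuclideanSpace.single 1 1) 2 -
            fderiv ℝ (fun x => fderiv ℝ (v z.1) x (EuclideanSpace.single 2 1) 2) z.2 (EuclideanSpace.single 1 1) *
              fderiv ℝ (v z.1) z.2 (EuclideanSpace.single 0 1) 2 ≠ 0) →
        ∀ a b : ℝ, W ⊆ Set.Ioo a b ×ˢ Set.univ →
          (∀ s ∈ Set.Ioo a b, ∀ y : EuclideanSpace ℝ (Fin 3),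
            0 ≤ fderiv ℝ (v s) y (EuclideanSpace.single 2 1) 0 * fderiv ℝ (v s) y (EuclideanSpace.single 0 1) 2 +
              fderiv ℝ (v s) y (EuclideanSpace.single 2 1) 1 * fderiv ℝ (v s) y (EuclideanSpace.single 1 1) 2) →
        (∀ m : ℝ → ℝ → ℝ, ∀ W₁ : Set (ℝ × EuclideanSpace ℝ (Fin 3)), W₁ ⊆ W → IsOpen W₁ → W₁.Nonempty →
          ∃ z ∈ W₁, ∃ b : Fin 3, b ≠ 2 ∧
            fderiv ℝ (v z.1) z.2 (EuclideanSpace.single 2 1) b ≠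
              m z.1 (z.2 2) * fderiv ℝ (v z.1) z.2 (EuclideanSpace.single b 1) 2) →
        ¬ Literature.Analysis.FluidPDE.IsBackwardSingularPoint v 0 := by
  intro C v hrate hcont hmild hdiv hpol W hW hWne hWs hnd hpin htw a b hab hslab hthick
  exact killingDoor C v hrate hcont hmild
    (stub_rigidSemiEllipticThick C v hrate hcont hmild hdiv hpol W hW hWne hWs hnd hpin htw a b hab hslab hthick)

/-! ### Composition, layer 2 (proved): `lrc_jet` v5's `stub_twisting` by Theorem A's census form `twisting_regular_of_three` -/

/-- `lrc_jet` v5 `stub_twisting`, VERBATIM, from the three layer-1 theorems via the tree theorem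
`…ThmAThreeStubs.twisting_regular_of_three` (K2-p2 g6, p581287: type dichotomy + Theorem A relocation). -/
theorem twisting_of_killing :
    ∀ (C : ℝ) (v : ℝ → EuclideanSpace ℝ (Fin 3) → EuclideanSpace ℝ (Fin 3)),
      Literature.Analysis.FluidPDE.HasTypeITimeDecay C v →
      ContinuousOn (Function.uncurry v) (Set.Iio (0 : ℝ) ×ˢ Set.univ) →
      (∀ s t : ℝ, s < t → t < 0 → ∀ x, v t x =
        Literature.Analysis.UnboundedOperators.heatExtension (v s) (t - s) x -
          Literature.Analysis.FluidPDE.oseenDuhamel 1 s v v t x) →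
      (∀ t < 0, Literature.Analysis.FluidPDE.VectorCalculus.IsDivFree (v t)) →
      (∀ s < 0, ∀ y, ⟪Literature.Analysis.FluidPDE.curl (v s) y, EuclideanSpace.single 2 1⟫_ℝ = 0) →
      ∀ W : Set (ℝ × EuclideanSpace ℝ (Fin 3)), IsOpen W → W.Nonempty → W ⊆ Set.Iio (0 : ℝ) ×ˢ Set.univ →
        (∀ z ∈ W, Literature.Analysis.FluidPDE.curl (v z.1) z.2 ≠ 0 ∧
          (fderiv ℝ (v z.1) z.2 (EuclideanSpace.single 0 1) 2 ≠ 0 ∨ fderiv ℝ (v z.1) z.2 (EuclideanSpace.single 1 1) 2 ≠ 0) ∧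
          (fderiv ℝ (v z.1) z.2 (EuclideanSpace.single 2 1) 0 ≠ 0 ∨ fderiv ℝ (v z.1) z.2 (EuclideanSpace.single 2 1) 1 ≠ 0)) →
        (∀ m : ℝ → ℝ, ∀ W₁ : Set (ℝ × EuclideanSpace ℝ (Fin 3)), W₁ ⊆ W → IsOpen W₁ → W₁.Nonempty →
          ∃ z ∈ W₁, ∃ b : Fin 3, b ≠ 2 ∧
            fderiv ℝ (v z.1) z.2 (EuclideanSpace.single 2 1) b ≠
              m z.1 * fderiv ℝ (v z.1) z.2 (EuclideanSpace.single b 1) 2) →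
        (∀ z ∈ W,
          fderiv ℝ (fun x => fderiv ℝ (v z.1) x (EuclideanSpace.single 2 1) 2) z.2 (EuclideanSpace.single 0 1) *
              fderiv ℝ (v z.1) z.2 (EuclideanSpace.single 1 1) 2 -
            fderiv ℝ (fun x => fderiv ℝ (v z.1) x (EuclideanSpace.single 2 1) 2) z.2 (EuclideanSpace.single 1 1) *
              fderiv ℝ (v z.1) z.2 (EuclideanSpace.single 0 1) 2 ≠ 0) →
        ¬ Literature.Analysis.FluidPDE.IsBackwardSingularPoint v 0 := by
  intro C v hrate hcont hmild hdiv hpol W hW hWne hWs hnd hpin htw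
  exact twisting_regular_of_three C v hrate hcont hmild hdiv
    (hyperbolicTH_of_killing C v hrate hcont hmild hdiv hpol)
    (hyperbolicThick_of_killing C v hrate hcont hmild hdiv hpol)
    (semiEllipticThick_of_killing C v hrate hcont hmild hdiv hpol)
    W hW hWne hWs hnd hpin htw

/-- `lrc_jet` v5 `stub_untwisted` — the TREE THEOREM `…StubUntwisted.stub_untwisted` (K2-p1 g6, p561151). -/
theorem untwisted_tree :
    ∀ (C : ℝ) (v : ℝ → EuclideanSpace ℝ (Fin 3) → EuclideanSpace ℝ (Fin 3)),
      Literature.Analysis.FluidPDE.HasTypeITimeDecay C v →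
      ContinuousOn (Function.uncurry v) (Set.Iio (0 : ℝ) ×ˢ Set.univ) →
      (∀ s t : ℝ, s < t → t < 0 → ∀ x, v t x =
        Literature.Analysis.UnboundedOperators.heatExtension (v s) (t - s) x -
          Literature.Analysis.FluidPDE.oseenDuhamel 1 s v v t x) →
      (∀ t < 0, Literature.Analysis.FluidPDE.VectorCalculus.IsDivFree (v t)) →
      (∀ s < 0, ∀ y, ⟪Literature.Analysis.FluidPDE.curl (v s) y, EuclideanSpace.single 2 1⟫_ℝ = 0) →
      ∀ W : Set (ℝ × EuclideanSpace ℝ (Fin 3)), IsOpen W → W.Nonempty → W ⊆ Set.Iio (0 : ℝ) ×ˢ Set.univ →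
        (∀ z ∈ W, Literature.Analysis.FluidPDE.curl (v z.1) z.2 ≠ 0 ∧
          (fderiv ℝ (v z.1) z.2 (EuclideanSpace.single 0 1) 2 ≠ 0 ∨ fderiv ℝ (v z.1) z.2 (EuclideanSpace.single 1 1) 2 ≠ 0) ∧
          (fderiv ℝ (v z.1) z.2 (EuclideanSpace.single 2 1) 0 ≠ 0 ∨ fderiv ℝ (v z.1) z.2 (EuclideanSpace.single 2 1) 1 ≠ 0)) →
        (∀ z ∈ W,
          fderiv ℝ (fun x => fderiv ℝ (v z.1) x (EuclideanSpace.single 2 1) 2) z.2 (EuclideanSpace.single 0 1) *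
              fderiv ℝ (v z.1) z.2 (EuclideanSpace.single 1 1) 2 -
            fderiv ℝ (fun x => fderiv ℝ (v z.1) x (EuclideanSpace.single 2 1) 2) z.2 (EuclideanSpace.single 1 1) *
              fderiv ℝ (v z.1) z.2 (EuclideanSpace.single 0 1) 2 = 0) →
        ¬ Literature.Analysis.FluidPDE.IsBackwardSingularPoint v 0 :=
  Summit.NavierStokesRegularity.NavierStokesRegularity.Theorems.PoloidalWindowDoorPoloidalWindowRigidityStubUntwisted.stub_untwisted


/-- **NON-DEGENERATE + v3 PIN ⇒ regular (proved from the two stubs by the pointwise twist dichotomy).**  The twist bracket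
`T(s,y) = ∂₀(∂₂v₂)·∂₁v₂ − ∂₁(∂₂v₂)·∂₀v₂` is jointly continuous on the backward slab (the Jacobian entries of a class
profile and their spatial derivatives are jointly real-analytic there: `…K2OfLrcSlope.analyticOnNhd_uncurry_fderiv_entry`,
`…AnalyticPropagation.analyticOnNhd_uncurry_fderiv_slice_apply`).  Hence either `T ≡ 0` on `W` (`stub_untwisted`), or
`T ≠ 0` on the nonempty open subset `W ∩ {T ≠ 0}`, which inherits non-degeneracy and the pin (`stub_twisting`). -/
theorem ndRegular :
    ∀ (C : ℝ) (v : ℝ → EuclideanSpace ℝ (Fin 3) → EuclideanSpace ℝ (Fin 3)),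
      Literature.Analysis.FluidPDE.HasTypeITimeDecay C v →
      ContinuousOn (Function.uncurry v) (Set.Iio (0 : ℝ) ×ˢ Set.univ) →
      (∀ s t : ℝ, s < t → t < 0 → ∀ x, v t x =
        Literature.Analysis.UnboundedOperators.heatExtension (v s) (t - s) x -
          Literature.Analysis.FluidPDE.oseenDuhamel 1 s v v t x) →
      (∀ t < 0, Literature.Analysis.FluidPDE.VectorCalculus.IsDivFree (v t)) →
      (∀ s < 0, ∀ y, ⟪Literature.Analysis.FluidPDE.curl (v s) y, EuclideanSpace.single 2 1⟫_ℝ = 0) →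
      ∀ W : Set (ℝ × EuclideanSpace ℝ (Fin 3)), IsOpen W → W.Nonempty → W ⊆ Set.Iio (0 : ℝ) ×ˢ Set.univ →
        (∀ z ∈ W, Literature.Analysis.FluidPDE.curl (v z.1) z.2 ≠ 0 ∧
          (fderiv ℝ (v z.1) z.2 (EuclideanSpace.single 0 1) 2 ≠ 0 ∨ fderiv ℝ (v z.1) z.2 (EuclideanSpace.single 1 1) 2 ≠ 0) ∧
          (fderiv ℝ (v z.1) z.2 (EuclideanSpace.single 2 1) 0 ≠ 0 ∨ fderiv ℝ (v z.1) z.2 (EuclideanSpace.single 2 1) 1 ≠ 0)) →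
        (∀ m : ℝ → ℝ, ∀ W₁ : Set (ℝ × EuclideanSpace ℝ (Fin 3)), W₁ ⊆ W → IsOpen W₁ → W₁.Nonempty →
          ∃ z ∈ W₁, ∃ b : Fin 3, b ≠ 2 ∧
            fderiv ℝ (v z.1) z.2 (EuclideanSpace.single 2 1) b ≠
              m z.1 * fderiv ℝ (v z.1) z.2 (EuclideanSpace.single b 1) 2) →
        ¬ Literature.Analysis.FluidPDE.IsBackwardSingularPoint v 0 := by
  intro C v hrate hcont hmild hdiv hpol W hW hWne hWs hnd hpin
  -- the twist bracket as a function on space–time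
  set T : ℝ × EuclideanSpace ℝ (Fin 3) → ℝ := fun z =>
    fderiv ℝ (fun x => fderiv ℝ (v z.1) x (EuclideanSpace.single 2 1) 2) z.2 (EuclideanSpace.single 0 1) *
              fderiv ℝ (v z.1) z.2 (EuclideanSpace.single 1 1) 2 -
            fderiv ℝ (fun x => fderiv ℝ (v z.1) x (EuclideanSpace.single 2 1) 2) z.2 (EuclideanSpace.single 1 1) *
              fderiv ℝ (v z.1) z.2 (EuclideanSpace.single 0 1) 2 with hT
  by_cases htw : ∃ z ∈ W, T z ≠ 0
  · -- TWISTING somewhere: restrict to the open set where `T ≠ 0`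
    obtain ⟨z₀, hz₀W, hz₀⟩ := htw
    have hslab : IsOpen (Set.Iio (0 : ℝ) ×ˢ (Set.univ : Set (EuclideanSpace ℝ (Fin 3)))) :=
      isOpen_Iio.prod isOpen_univ
    have hD : ∀ j i : Fin 3, ContinuousOn
        (fun z : ℝ × EuclideanSpace ℝ (Fin 3) => fderiv ℝ (v z.1) z.2 (EuclideanSpace.single j 1) i)
        (Set.Iio (0 : ℝ) ×ˢ Set.univ) := fun j i => continuousOn_fderiv_entry hrate hcont hmild j i
    have hD2 : ∀ b : Fin 3, ContinuousOn
        (fun z : ℝ × EuclideanSpace ℝ (Fin 3) =>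
          fderiv ℝ (fun x => fderiv ℝ (v z.1) x (EuclideanSpace.single 2 1) 2) z.2 (EuclideanSpace.single b 1))
        (Set.Iio (0 : ℝ) ×ˢ Set.univ) := by
      intro b
      have h22 := analyticOnNhd_uncurry_fderiv_entry hrate hcont hmild 2 2
      have h := analyticOnNhd_uncurry_fderiv_slice_apply (w := fun s y => fderiv ℝ (v s) y (EuclideanSpace.single 2 1) 2)
        h22 isOpen_Iio (v := fun _ _ => EuclideanSpace.single b 1) analyticOnNhd_const
      exact h.continuousOn
    have hTc : ContinuousOn T (Set.Iio (0 : ℝ) ×ˢ Set.univ) := by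
      rw [hT]
      exact ((hD2 0).mul (hD 1 2)).sub ((hD2 1).mul (hD 0 2))
    have hO : IsOpen ((Set.Iio (0 : ℝ) ×ˢ Set.univ) ∩ T ⁻¹' {0}ᶜ) :=
      hTc.isOpen_inter_preimage hslab isOpen_compl_singleton
    set W₃ : Set (ℝ × EuclideanSpace ℝ (Fin 3)) := W ∩ ((Set.Iio (0 : ℝ) ×ˢ Set.univ) ∩ T ⁻¹' {0}ᶜ) with hW₃
    have hW₃o : IsOpen W₃ := hW.inter hO
    have hW₃W : W₃ ⊆ W := Set.inter_subset_left
    have hW₃ne : W₃.Nonempty := ⟨z₀, hz₀W, hWs hz₀W, hz₀⟩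
    refine twisting_of_killing C v hrate hcont hmild hdiv hpol W₃ hW₃o hW₃ne (hW₃W.trans hWs)
      (fun z hz => hnd z (hW₃W hz)) (fun m W₁ hW₁ hW₁o hW₁ne => hpin m W₁ (hW₁.trans hW₃W) hW₁o hW₁ne) ?_
    intro z hz
    exact hz.2.2
  · -- UNTWISTED on all of `W`
    push Not at htw
    exact untwisted_tree C v hrate hcont hmild hdiv hpol W hW hWne hWs hnd htw

/-- **LRC″ with spatial pins, UNDER THE SINGULARITY ASSUMPTION, from the two stubs** (proved): the hypothesis `hLRC`
of `…K2OfLrcSpatial.nonflatLiouville_of_lrc_spatial` for a profile that IS backward-singular at the apex — vacuously, since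
`ndRegular` (the twist dichotomy over the two stubs) says such a profile has no non-degenerate open set with the pin. -/
theorem lrcSpatial_of_stubs :
    ∀ (C : ℝ) (v : ℝ → EuclideanSpace ℝ (Fin 3) → EuclideanSpace ℝ (Fin 3)),
      Literature.Analysis.FluidPDE.HasTypeITimeDecay C v →
      ContinuousOn (Function.uncurry v) (Set.Iio (0 : ℝ) ×ˢ Set.univ) →
      (∀ s t : ℝ, s < t → t < 0 → ∀ x, v t x =
        Literature.Analysis.UnboundedOperators.heatExtension (v s) (t - s) x -
          Literature.Analysis.FluidPDE.oseenDuhamel 1 s v v t x) →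
      (∀ t < 0, Literature.Analysis.FluidPDE.VectorCalculus.IsDivFree (v t)) →
      (∀ s < 0, ∀ y, ⟪Literature.Analysis.FluidPDE.curl (v s) y, EuclideanSpace.single 2 1⟫_ℝ = 0) →
      Literature.Analysis.FluidPDE.IsBackwardSingularPoint v 0 →
      ∀ W : Set (ℝ × EuclideanSpace ℝ (Fin 3)), IsOpen W → W.Nonempty → W ⊆ Set.Iio (0 : ℝ) ×ˢ Set.univ →
        (∀ z ∈ W, Literature.Analysis.FluidPDE.curl (v z.1) z.2 ≠ 0 ∧
          (fderiv ℝ (v z.1) z.2 (EuclideanSpace.single 0 1) 2 ≠ 0 ∨ fderiv ℝ (v z.1) z.2 (EuclideanSpace.single 1 1) 2 ≠ 0) ∧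
          (fderiv ℝ (v z.1) z.2 (EuclideanSpace.single 2 1) 0 ≠ 0 ∨ fderiv ℝ (v z.1) z.2 (EuclideanSpace.single 2 1) 1 ≠ 0)) →
        (∀ m : ℝ → ℝ, ∀ W₁ : Set (ℝ × EuclideanSpace ℝ (Fin 3)), W₁ ⊆ W → IsOpen W₁ → W₁.Nonempty →
          ∃ z ∈ W₁, ∃ b : Fin 3, b ≠ 2 ∧
            fderiv ℝ (v z.1) z.2 (EuclideanSpace.single 2 1) b ≠
              m z.1 * fderiv ℝ (v z.1) z.2 (EuclideanSpace.single b 1) 2) →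
        ∃ s : ℝ, s < 0 ∧ ∃ U : Set (EuclideanSpace ℝ (Fin 3)), IsOpen U ∧ U.Nonempty ∧
          ((∃ e : EuclideanSpace ℝ (Fin 3), e ≠ 0 ∧ ∀ y ∈ U, fderiv ℝ (Literature.Analysis.FluidPDE.curl (v s)) y e = 0) ∨
           (∃ c : EuclideanSpace ℝ (Fin 3), ∀ y ∈ U,
              Literature.Analysis.FluidPDE.rotGen (Literature.Analysis.FluidPDE.curl (v s) y) =
                fderiv ℝ (Literature.Analysis.FluidPDE.curl (v s)) y (Literature.Analysis.FluidPDE.rotGen (y - c)))) := by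
  intro C v hrate hcont hmild hdiv hpol hsing W hW hWne hWs hnd hpin
  exact absurd hsing (ndRegular C v hrate hcont hmild hdiv hpol W hW hWne hWs hnd hpin)

/-- **(former STUB L2, now a TREE THEOREM) = (TV), BOUNDED-ALONG-A-SEQUENCE HALF** — the registered stub
`stub_tvLiminf` of v2, PROVED by ns-poloidal-K2-p2 g3 (p525351 `…TimeShearLiminf.stub_tvLiminf`, M12 variance run on
`ψ = (1−μ)v₂` with the Grönwall started along the bounded sequence; bricks ns-poloidal-K2-p3 g4 p519098/p521329, K2-p2
p524146/p524699).  For a profile of the route's Type-I class, poloidal along `e₃`: if every slice `s < 0` is proportional-shear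
with a negative real-analytic non-constant slope function bounded below along SOME sequence of times tending to `−∞`, then
`v` is not backward-singular at the apex. -/
theorem tvLiminf_tree :
    ∀ (C : ℝ) (v : ℝ → EuclideanSpace ℝ (Fin 3) → EuclideanSpace ℝ (Fin 3)),
      Literature.Analysis.FluidPDE.HasTypeITimeDecay C v →
      ContinuousOn (Function.uncurry v) (Set.Iio (0 : ℝ) ×ˢ Set.univ) →
      (∀ s t : ℝ, s < t → t < 0 → ∀ x, v t x =
        Literature.Analysis.UnboundedOperators.heatExtension (v s) (t - s) x -
          Literature.Analysis.FluidPDE.oseenDuhamel 1 s v v t x) →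
      (∀ t < 0, Literature.Analysis.FluidPDE.VectorCalculus.IsDivFree (v t)) →
      (∀ s < 0, ∀ y, ⟪Literature.Analysis.FluidPDE.curl (v s) y, EuclideanSpace.single 2 1⟫_ℝ = 0) →
      ∀ μ : ℝ → ℝ, (∀ s < 0, μ s < 0) → (∀ s < 0, AnalyticAt ℝ μ s) →
        (∃ s₁ s₂ : ℝ, s₁ < 0 ∧ s₂ < 0 ∧ μ s₁ ≠ μ s₂) →
        (∀ s < 0, ∀ y, ∀ b : Fin 3, b ≠ 2 →
          fderiv ℝ (v s) y (EuclideanSpace.single 2 1) b = μ s * fderiv ℝ (v s) y (EuclideanSpace.single b 1) 2) →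
        (∃ M : ℝ, ∀ T : ℝ, ∃ τ < T, -M ≤ μ τ) →
        ¬ Literature.Analysis.FluidPDE.IsBackwardSingularPoint v 0 :=
  Summit.NavierStokesRegularity.NavierStokesRegularity.Theorems.PoloidalWindowDoorPoloidalWindowRigidityTimeShearLiminf.stub_tvLiminf

/-- **(TV) from the two halves (proved).**  The hypothesis `hTV` of `…K2OfLrcSpatial.nonflatLiouville_of_lrc_spatial`,
quantified over the class: the bounded-along-a-sequence half is `stub_tvLiminf`; otherwise `μ(τ) → −∞`, i.e.
`∀ M ∃ T ∀ τ < T, M ≤ |μ τ|`, and the lead's tree theorem `…HorizontalFlatPast.nonflatLiouville_of_timeShear_unbounded`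
(growth branch, zoom-out) ends. -/
theorem tv_of_stubs :
    ∀ (C : ℝ) (v : ℝ → EuclideanSpace ℝ (Fin 3) → EuclideanSpace ℝ (Fin 3)),
      Literature.Analysis.FluidPDE.HasTypeITimeDecay C v →
      ContinuousOn (Function.uncurry v) (Set.Iio (0 : ℝ) ×ˢ Set.univ) →
      (∀ s t : ℝ, s < t → t < 0 → ∀ x, v t x =
        Literature.Analysis.UnboundedOperators.heatExtension (v s) (t - s) x -
          Literature.Analysis.FluidPDE.oseenDuhamel 1 s v v t x) →
      (∀ t < 0, Literature.Analysis.FluidPDE.VectorCalculus.IsDivFree (v t)) →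
      (∀ s < 0, ∀ y, ⟪Literature.Analysis.FluidPDE.curl (v s) y, EuclideanSpace.single 2 1⟫_ℝ = 0) →
      ∀ μ : ℝ → ℝ, (∀ s < 0, μ s < 0) → (∀ s < 0, AnalyticAt ℝ μ s) →
        (∃ s₁ s₂ : ℝ, s₁ < 0 ∧ s₂ < 0 ∧ μ s₁ ≠ μ s₂) →
        (∀ s < 0, ∀ y, ∀ b : Fin 3, b ≠ 2 →
          fderiv ℝ (v s) y (EuclideanSpace.single 2 1) b = μ s * fderiv ℝ (v s) y (EuclideanSpace.single b 1) 2) →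
        ¬ Literature.Analysis.FluidPDE.IsBackwardSingularPoint v 0 := by
  intro C v hrate hcont hmild hdiv hpol μ hneg han hnc hslope
  by_cases hB : ∃ M : ℝ, ∀ T : ℝ, ∃ τ < T, -M ≤ μ τ
  · exact tvLiminf_tree C v hrate hcont hmild hdiv hpol μ hneg han hnc hslope hB
  · push Not at hB
    refine nonflatLiouville_of_timeShear_unbounded hrate hcont hmild hdiv hpol hslope fun M => ?_
    obtain ⟨T, hT⟩ := hB M
    refine ⟨T, fun τ hτ => ?_⟩
    have h1 : μ τ < -M := hT τ hτ
    have h2 : M < -μ τ := by linarith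
    exact h2.le.trans (neg_le_abs (μ τ))

/-- **The slice-sharp residue of the `slicesharp` line from the two stubs** (its symmetry/genericity hypotheses are not
needed): class + poloidal ⇒ not backward-singular — by contradiction, K2-p3 g4's `nonflatLiouville_of_lrc_spatial` with
`lrcSpatial_of_stubs` (which uses the assumed singularity) and `tv_of_stubs`. -/
theorem sliceSharpNonflatLiouville_of_killingDoor :
    ∀ (C : ℝ) (v : ℝ → EuclideanSpace ℝ (Fin 3) → EuclideanSpace ℝ (Fin 3)),
      Literature.Analysis.FluidPDE.HasTypeITimeDecay C v →
      ContinuousOn (Function.uncurry v) (Set.Iio (0 : ℝ) ×ˢ Set.univ) →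
      (∀ s t : ℝ, s < t → t < 0 → ∀ x, v t x =
        Literature.Analysis.UnboundedOperators.heatExtension (v s) (t - s) x -
          Literature.Analysis.FluidPDE.oseenDuhamel 1 s v v t x) →
      (∀ t < 0, Literature.Analysis.FluidPDE.VectorCalculus.IsDivFree (v t)) →
      (∀ s < 0, ∀ y, ⟪Literature.Analysis.FluidPDE.curl (v s) y, EuclideanSpace.single 2 1⟫_ℝ = 0) →
      (∀ s < 0, ∀ y, ⟪fderiv ℝ (v s) y (Literature.Analysis.FluidPDE.curl (v s) y), EuclideanSpace.single 2 1⟫_ℝ = 0) →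
      (∀ s < 0, ∀ b : EuclideanSpace ℝ (Fin 3), b ≠ 0 → ∃ y,
        Literature.Analysis.FluidPDE.cross (Literature.Analysis.FluidPDE.curl (v s) y) b ≠ 0) →
      (∀ s < 0, ∃ y, fderiv ℝ (v s) y (EuclideanSpace.single 2 1) 0 ≠ 0 ∨
        fderiv ℝ (v s) y (EuclideanSpace.single 2 1) 1 ≠ 0) →
      (∀ s < 0, ∀ a : EuclideanSpace ℝ (Fin 3), a ≠ 0 → ⟪a, EuclideanSpace.single 2 1⟫_ℝ = 0 →
        ∃ y, ⟪fderiv ℝ (v s) y a, EuclideanSpace.single 2 1⟫_ℝ ≠ 0) →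
      (∀ s < 0, ∀ e : EuclideanSpace ℝ (Fin 3), e ≠ 0 → ∃ (y : EuclideanSpace ℝ (Fin 3)) (l : ℝ), v s (y + l • e) ≠ v s y) →
      (∀ s < 0, ∀ (L : EuclideanSpace ℝ (Fin 3) ≃ₗᵢ[ℝ] EuclideanSpace ℝ (Fin 3)) (c : EuclideanSpace ℝ (Fin 3)),
        ¬ Literature.Analysis.FluidPDE.IsAxisymmetric (fun y => L.symm (v s (L y + c)))) →
      (∃ lam : ℝ, 0 < lam ∧ ∃ s < 0, ∃ y, lam • v (lam ^ 2 * s) (lam • y) ≠ v s y) →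
      ¬ Literature.Analysis.FluidPDE.IsBackwardSingularPoint v 0 := by
  intro C v hrate hcont hmild hdiv hpol _ _ _ _ _ _ _ hsing
  exact nonflatLiouville_of_lrc_spatial hrate hcont hmild hdiv hpol
    (lrcSpatial_of_stubs C v hrate hcont hmild hdiv hpol hsing) (tv_of_stubs C v hrate hcont hmild hdiv hpol) hsing

/-- **COMPOSITION (proved): the crux `PoloidalWindowRigidity` from the four stubs K0, R1–R3**, via `twisting_of_killing` (layer 2),
the tree theorem `untwisted_tree` (= `…StubUntwisted.stub_untwisted`) and the landed reduction `…Sharper.poloidalWindowRigidity_of_sliceSharpNonflatLiouville`. -/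
theorem PoloidalWindowRigidity_of_killingDoor :
    Summit.NavierStokesRegularity.NavierStokesRegularity.Theses.PoloidalWindowDoor.PoloidalWindowRigidity :=
  poloidalWindowRigidity_of_sliceSharpNonflatLiouville sliceSharpNonflatLiouville_of_killingDoor

/-! ### The emptiness currency still closes R2 and R3 BY NAME (proved; R1 ⇐ `hemptyHypNF` is p589072's argument with its
conclusion irrelevant — a four-line localisation file for a prover, not restated here) -/

open scoped Laplacian

/-- **`hempty_thick ⇒ R2`** (proved, four lines, same as `mixed_type` v2's closer): K2-p4's
`…ThickStubsOfLocalEmpty.exists_timeHeight_subwindow_of_localEmptyThick` yields a time–height sub-window, contradicting the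
thickness clause — so a thick emptiness certificate closes the WEAKER stub too (its hypotheses are inconsistent). -/
theorem rigidHyperbolicThick_of_localEmptyThick (hempty_thick : ∀ (u : ℝ → EuclideanSpace ℝ (Fin 3) → EuclideanSpace ℝ (Fin 3))
      (U : Set (ℝ × EuclideanSpace ℝ (Fin 3))) (p₀ : ℝ × EuclideanSpace ℝ (Fin 3)),
      IsOpen U → p₀ ∈ U →
      AnalyticOnNhd ℝ (Function.uncurry u) U →
      (∀ p ∈ U, fderiv ℝ (u p.1) p.2 (EuclideanSpace.single 0 1) 0 + fderiv ℝ (u p.1) p.2 (EuclideanSpace.single 1 1) 1 +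
        fderiv ℝ (u p.1) p.2 (EuclideanSpace.single 2 1) 2 = 0) →
      (∀ p ∈ U, fderiv ℝ (u p.1) p.2 (EuclideanSpace.single 0 1) 1 = fderiv ℝ (u p.1) p.2 (EuclideanSpace.single 1 1) 0) →
      (∀ p ∈ U, fderiv ℝ (u p.1) p.2 (EuclideanSpace.single 2 1) 0 * fderiv ℝ (u p.1) p.2 (EuclideanSpace.single 1 1) 2 -
        fderiv ℝ (u p.1) p.2 (EuclideanSpace.single 2 1) 1 * fderiv ℝ (u p.1) p.2 (EuclideanSpace.single 0 1) 2 = 0) →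
      (∀ p ∈ U, ∀ j k : Fin 3,
        fderiv ℝ (fun y => deriv (fun s => u s y k) p.1 + fderiv ℝ (fun y' => u p.1 y' k) y (u p.1 y) -
            (Δ (fun y' => u p.1 y' k)) y) p.2 (EuclideanSpace.single j 1) =
          fderiv ℝ (fun y => deriv (fun s => u s y j) p.1 + fderiv ℝ (fun y' => u p.1 y' j) y (u p.1 y) -
            (Δ (fun y' => u p.1 y' j)) y) p.2 (EuclideanSpace.single k 1)) →
      fderiv ℝ (fun y => fderiv ℝ (u p₀.1) y (EuclideanSpace.single 2 1) 2) p₀.2 (EuclideanSpace.single 0 1) *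
            fderiv ℝ (u p₀.1) p₀.2 (EuclideanSpace.single 1 1) 2 -
          fderiv ℝ (fun y => fderiv ℝ (u p₀.1) y (EuclideanSpace.single 2 1) 2) p₀.2 (EuclideanSpace.single 1 1) *
            fderiv ℝ (u p₀.1) p₀.2 (EuclideanSpace.single 0 1) 2 ≠ 0 →
      (fderiv ℝ (u p₀.1) p₀.2 (EuclideanSpace.single 0 1) 2 ≠ 0 ∨ fderiv ℝ (u p₀.1) p₀.2 (EuclideanSpace.single 1 1) 2 ≠ 0) →
      (fderiv ℝ (u p₀.1) p₀.2 (EuclideanSpace.single 2 1) 0 ≠ 0 ∨ fderiv ℝ (u p₀.1) p₀.2 (EuclideanSpace.single 2 1) 1 ≠ 0) →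
      Literature.Analysis.FluidPDE.curl (u p₀.1) p₀.2 ≠ 0 →
      (fderiv ℝ (fun y =>
            (fderiv ℝ (u p₀.1) y (EuclideanSpace.single 2 1) 0 * fderiv ℝ (u p₀.1) y (EuclideanSpace.single 0 1) 2 +
                fderiv ℝ (u p₀.1) y (EuclideanSpace.single 2 1) 1 * fderiv ℝ (u p₀.1) y (EuclideanSpace.single 1 1) 2) /
              (fderiv ℝ (u p₀.1) y (EuclideanSpace.single 0 1) 2 ^ 2 + fderiv ℝ (u p₀.1) y (EuclideanSpace.single 1 1) 2 ^ 2))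
            p₀.2 (EuclideanSpace.single 0 1) ≠ 0 ∨
        fderiv ℝ (fun y =>
            (fderiv ℝ (u p₀.1) y (EuclideanSpace.single 2 1) 0 * fderiv ℝ (u p₀.1) y (EuclideanSpace.single 0 1) 2 +
                fderiv ℝ (u p₀.1) y (EuclideanSpace.single 2 1) 1 * fderiv ℝ (u p₀.1) y (EuclideanSpace.single 1 1) 2) /
              (fderiv ℝ (u p₀.1) y (EuclideanSpace.single 0 1) 2 ^ 2 + fderiv ℝ (u p₀.1) y (EuclideanSpace.single 1 1) 2 ^ 2))
            p₀.2 (EuclideanSpace.single 1 1) ≠ 0) →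
      False) :
    ∀ (C : ℝ) (v : ℝ → EuclideanSpace ℝ (Fin 3) → EuclideanSpace ℝ (Fin 3)),
      Literature.Analysis.FluidPDE.HasTypeITimeDecay C v →
      ContinuousOn (Function.uncurry v) (Set.Iio (0 : ℝ) ×ˢ Set.univ) →
      (∀ s t : ℝ, s < t → t < 0 → ∀ x, v t x =
        Literature.Analysis.UnboundedOperators.heatExtension (v s) (t - s) x -
          Literature.Analysis.FluidPDE.oseenDuhamel 1 s v v t x) →
      (∀ t < 0, Literature.Analysis.FluidPDE.VectorCalculus.IsDivFree (v t)) →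
      (∀ s < 0, ∀ y, ⟪Literature.Analysis.FluidPDE.curl (v s) y, EuclideanSpace.single 2 1⟫_ℝ = 0) →
      ∀ W : Set (ℝ × EuclideanSpace ℝ (Fin 3)), IsOpen W → W.Nonempty → W ⊆ Set.Iio (0 : ℝ) ×ˢ Set.univ →
        (∀ z ∈ W, Literature.Analysis.FluidPDE.curl (v z.1) z.2 ≠ 0 ∧
          (fderiv ℝ (v z.1) z.2 (EuclideanSpace.single 0 1) 2 ≠ 0 ∨ fderiv ℝ (v z.1) z.2 (EuclideanSpace.single 1 1) 2 ≠ 0) ∧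
          (fderiv ℝ (v z.1) z.2 (EuclideanSpace.single 2 1) 0 ≠ 0 ∨ fderiv ℝ (v z.1) z.2 (EuclideanSpace.single 2 1) 1 ≠ 0)) →
        (∀ m : ℝ → ℝ, ∀ W₁ : Set (ℝ × EuclideanSpace ℝ (Fin 3)), W₁ ⊆ W → IsOpen W₁ → W₁.Nonempty →
          ∃ z ∈ W₁, ∃ b : Fin 3, b ≠ 2 ∧
            fderiv ℝ (v z.1) z.2 (EuclideanSpace.single 2 1) b ≠
              m z.1 * fderiv ℝ (v z.1) z.2 (EuclideanSpace.single b 1) 2) →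
        (∀ z ∈ W,
          fderiv ℝ (fun x => fderiv ℝ (v z.1) x (EuclideanSpace.single 2 1) 2) z.2 (EuclideanSpace.single 0 1) *
              fderiv ℝ (v z.1) z.2 (EuclideanSpace.single 1 1) 2 -
            fderiv ℝ (fun x => fderiv ℝ (v z.1) x (EuclideanSpace.single 2 1) 2) z.2 (EuclideanSpace.single 1 1) *
              fderiv ℝ (v z.1) z.2 (EuclideanSpace.single 0 1) 2 ≠ 0) →
        (∀ z ∈ W,
          fderiv ℝ (v z.1) z.2 (EuclideanSpace.single 2 1) 0 * fderiv ℝ (v z.1) z.2 (EuclideanSpace.single 0 1) 2 +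
            fderiv ℝ (v z.1) z.2 (EuclideanSpace.single 2 1) 1 * fderiv ℝ (v z.1) z.2 (EuclideanSpace.single 1 1) 2 < 0) →
        (∀ m : ℝ → ℝ → ℝ, ∀ W₁ : Set (ℝ × EuclideanSpace ℝ (Fin 3)), W₁ ⊆ W → IsOpen W₁ → W₁.Nonempty →
          ∃ z ∈ W₁, ∃ b : Fin 3, b ≠ 2 ∧
            fderiv ℝ (v z.1) z.2 (EuclideanSpace.single 2 1) b ≠
              m z.1 (z.2 2) * fderiv ℝ (v z.1) z.2 (EuclideanSpace.single b 1) 2) →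
        ∃ W₁ : Set (ℝ × EuclideanSpace ℝ (Fin 3)), IsOpen W₁ ∧ W₁.Nonempty ∧ W₁ ⊆ Set.Iio (0 : ℝ) ×ˢ Set.univ ∧
          ∃ (c : EuclideanSpace ℝ (Fin 3)) (S : EuclideanSpace ℝ (Fin 3) →L[ℝ] EuclideanSpace ℝ (Fin 3)),
            (∀ x y : EuclideanSpace ℝ (Fin 3), ⟪S x, y⟫_ℝ = -⟪x, S y⟫_ℝ) ∧
            ∀ z ∈ W₁, deriv (fun τ => v τ z.2) z.1 + fderiv ℝ (v z.1) z.2 (c + S z.2) - S (v z.1 z.2) = 0 := by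
  intro C v hrate hcont hmild hdiv hpol W hW hWne hWs hnd _ htw _ hthick
  obtain ⟨U₁, hU₁W, hU₁o, hU₁ne, m, hm⟩ :=
    Summit.NavierStokesRegularity.NavierStokesRegularity.Theorems.PoloidalWindowDoorPoloidalWindowRigidityThickStubsOfLocalEmpty.exists_timeHeight_subwindow_of_localEmptyThick
      hempty_thick hrate hcont hmild hdiv hpol hW hWne hWs hnd htw
  obtain ⟨z, hz, b, hb, hne⟩ := hthick m U₁ hU₁W hU₁o hU₁ne
  exact absurd (hm z hz b hb) hne

/-- **`hempty_thick ⇒ R3`** (proved, same four lines). -/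
theorem rigidSemiEllipticThick_of_localEmptyThick (hempty_thick : ∀ (u : ℝ → EuclideanSpace ℝ (Fin 3) → EuclideanSpace ℝ (Fin 3))
      (U : Set (ℝ × EuclideanSpace ℝ (Fin 3))) (p₀ : ℝ × EuclideanSpace ℝ (Fin 3)),
      IsOpen U → p₀ ∈ U →
      AnalyticOnNhd ℝ (Function.uncurry u) U →
      (∀ p ∈ U, fderiv ℝ (u p.1) p.2 (EuclideanSpace.single 0 1) 0 + fderiv ℝ (u p.1) p.2 (EuclideanSpace.single 1 1) 1 +
        fderiv ℝ (u p.1) p.2 (EuclideanSpace.single 2 1) 2 = 0) →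
      (∀ p ∈ U, fderiv ℝ (u p.1) p.2 (EuclideanSpace.single 0 1) 1 = fderiv ℝ (u p.1) p.2 (EuclideanSpace.single 1 1) 0) →
      (∀ p ∈ U, fderiv ℝ (u p.1) p.2 (EuclideanSpace.single 2 1) 0 * fderiv ℝ (u p.1) p.2 (EuclideanSpace.single 1 1) 2 -
        fderiv ℝ (u p.1) p.2 (EuclideanSpace.single 2 1) 1 * fderiv ℝ (u p.1) p.2 (EuclideanSpace.single 0 1) 2 = 0) →
      (∀ p ∈ U, ∀ j k : Fin 3,
        fderiv ℝ (fun y => deriv (fun s => u s y k) p.1 + fderiv ℝ (fun y' => u p.1 y' k) y (u p.1 y) -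
            (Δ (fun y' => u p.1 y' k)) y) p.2 (EuclideanSpace.single j 1) =
          fderiv ℝ (fun y => deriv (fun s => u s y j) p.1 + fderiv ℝ (fun y' => u p.1 y' j) y (u p.1 y) -
            (Δ (fun y' => u p.1 y' j)) y) p.2 (EuclideanSpace.single k 1)) →
      fderiv ℝ (fun y => fderiv ℝ (u p₀.1) y (EuclideanSpace.single 2 1) 2) p₀.2 (EuclideanSpace.single 0 1) *
            fderiv ℝ (u p₀.1) p₀.2 (EuclideanSpace.single 1 1) 2 -
          fderiv ℝ (fun y => fderiv ℝ (u p₀.1) y (EuclideanSpace.single 2 1) 2) p₀.2 (EuclideanSpace.single 1 1) *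
            fderiv ℝ (u p₀.1) p₀.2 (EuclideanSpace.single 0 1) 2 ≠ 0 →
      (fderiv ℝ (u p₀.1) p₀.2 (EuclideanSpace.single 0 1) 2 ≠ 0 ∨ fderiv ℝ (u p₀.1) p₀.2 (EuclideanSpace.single 1 1) 2 ≠ 0) →
      (fderiv ℝ (u p₀.1) p₀.2 (EuclideanSpace.single 2 1) 0 ≠ 0 ∨ fderiv ℝ (u p₀.1) p₀.2 (EuclideanSpace.single 2 1) 1 ≠ 0) →
      Literature.Analysis.FluidPDE.curl (u p₀.1) p₀.2 ≠ 0 →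
      (fderiv ℝ (fun y =>
            (fderiv ℝ (u p₀.1) y (EuclideanSpace.single 2 1) 0 * fderiv ℝ (u p₀.1) y (EuclideanSpace.single 0 1) 2 +
                fderiv ℝ (u p₀.1) y (EuclideanSpace.single 2 1) 1 * fderiv ℝ (u p₀.1) y (EuclideanSpace.single 1 1) 2) /
              (fderiv ℝ (u p₀.1) y (EuclideanSpace.single 0 1) 2 ^ 2 + fderiv ℝ (u p₀.1) y (EuclideanSpace.single 1 1) 2 ^ 2))
            p₀.2 (EuclideanSpace.single 0 1) ≠ 0 ∨
        fderiv ℝ (fun y =>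
            (fderiv ℝ (u p₀.1) y (EuclideanSpace.single 2 1) 0 * fderiv ℝ (u p₀.1) y (EuclideanSpace.single 0 1) 2 +
                fderiv ℝ (u p₀.1) y (EuclideanSpace.single 2 1) 1 * fderiv ℝ (u p₀.1) y (EuclideanSpace.single 1 1) 2) /
              (fderiv ℝ (u p₀.1) y (EuclideanSpace.single 0 1) 2 ^ 2 + fderiv ℝ (u p₀.1) y (EuclideanSpace.single 1 1) 2 ^ 2))
            p₀.2 (EuclideanSpace.single 1 1) ≠ 0) →
      False) :
    ∀ (C : ℝ) (v : ℝ → EuclideanSpace ℝ (Fin 3) → EuclideanSpace ℝ (Fin 3)),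
      Literature.Analysis.FluidPDE.HasTypeITimeDecay C v →
      ContinuousOn (Function.uncurry v) (Set.Iio (0 : ℝ) ×ˢ Set.univ) →
      (∀ s t : ℝ, s < t → t < 0 → ∀ x, v t x =
        Literature.Analysis.UnboundedOperators.heatExtension (v s) (t - s) x -
          Literature.Analysis.FluidPDE.oseenDuhamel 1 s v v t x) →
      (∀ t < 0, Literature.Analysis.FluidPDE.VectorCalculus.IsDivFree (v t)) →
      (∀ s < 0, ∀ y, ⟪Literature.Analysis.FluidPDE.curl (v s) y, EuclideanSpace.single 2 1⟫_ℝ = 0) →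
      ∀ W : Set (ℝ × EuclideanSpace ℝ (Fin 3)), IsOpen W → W.Nonempty → W ⊆ Set.Iio (0 : ℝ) ×ˢ Set.univ →
        (∀ z ∈ W, Literature.Analysis.FluidPDE.curl (v z.1) z.2 ≠ 0 ∧
          (fderiv ℝ (v z.1) z.2 (EuclideanSpace.single 0 1) 2 ≠ 0 ∨ fderiv ℝ (v z.1) z.2 (EuclideanSpace.single 1 1) 2 ≠ 0) ∧
          (fderiv ℝ (v z.1) z.2 (EuclideanSpace.single 2 1) 0 ≠ 0 ∨ fderiv ℝ (v z.1) z.2 (EuclideanSpace.single 2 1) 1 ≠ 0)) →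
        (∀ m : ℝ → ℝ, ∀ W₁ : Set (ℝ × EuclideanSpace ℝ (Fin 3)), W₁ ⊆ W → IsOpen W₁ → W₁.Nonempty →
          ∃ z ∈ W₁, ∃ b : Fin 3, b ≠ 2 ∧
            fderiv ℝ (v z.1) z.2 (EuclideanSpace.single 2 1) b ≠
              m z.1 * fderiv ℝ (v z.1) z.2 (EuclideanSpace.single b 1) 2) →
        (∀ z ∈ W,
          fderiv ℝ (fun x => fderiv ℝ (v z.1) x (EuclideanSpace.single 2 1) 2) z.2 (EuclideanSpace.single 0 1) *
              fderiv ℝ (v z.1) z.2 (EuclideanSpace.single 1 1) 2 -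
            fderiv ℝ (fun x => fderiv ℝ (v z.1) x (EuclideanSpace.single 2 1) 2) z.2 (EuclideanSpace.single 1 1) *
              fderiv ℝ (v z.1) z.2 (EuclideanSpace.single 0 1) 2 ≠ 0) →
        ∀ a b : ℝ, W ⊆ Set.Ioo a b ×ˢ Set.univ →
          (∀ s ∈ Set.Ioo a b, ∀ y : EuclideanSpace ℝ (Fin 3),
            0 ≤ fderiv ℝ (v s) y (EuclideanSpace.single 2 1) 0 * fderiv ℝ (v s) y (EuclideanSpace.single 0 1) 2 +
              fderiv ℝ (v s) y (EuclideanSpace.single 2 1) 1 * fderiv ℝ (v s) y (EuclideanSpace.single 1 1) 2) →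
        (∀ m : ℝ → ℝ → ℝ, ∀ W₁ : Set (ℝ × EuclideanSpace ℝ (Fin 3)), W₁ ⊆ W → IsOpen W₁ → W₁.Nonempty →
          ∃ z ∈ W₁, ∃ b : Fin 3, b ≠ 2 ∧
            fderiv ℝ (v z.1) z.2 (EuclideanSpace.single 2 1) b ≠
              m z.1 (z.2 2) * fderiv ℝ (v z.1) z.2 (EuclideanSpace.single b 1) 2) →
        ∃ W₁ : Set (ℝ × EuclideanSpace ℝ (Fin 3)), IsOpen W₁ ∧ W₁.Nonempty ∧ W₁ ⊆ Set.Iio (0 : ℝ) ×ˢ Set.univ ∧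
          ∃ (c : EuclideanSpace ℝ (Fin 3)) (S : EuclideanSpace ℝ (Fin 3) →L[ℝ] EuclideanSpace ℝ (Fin 3)),
            (∀ x y : EuclideanSpace ℝ (Fin 3), ⟪S x, y⟫_ℝ = -⟪x, S y⟫_ℝ) ∧
            ∀ z ∈ W₁, deriv (fun τ => v τ z.2) z.1 + fderiv ℝ (v z.1) z.2 (c + S z.2) - S (v z.1 z.2) = 0 := by
  intro C v hrate hcont hmild hdiv hpol W hW hWne hWs hnd _ htw _ _ _ _ hthick
  obtain ⟨U₁, hU₁W, hU₁o, hU₁ne, m, hm⟩ :=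
    Summit.NavierStokesRegularity.NavierStokesRegularity.Theorems.PoloidalWindowDoorPoloidalWindowRigidityThickStubsOfLocalEmpty.exists_timeHeight_subwindow_of_localEmptyThick
      hempty_thick hrate hcont hmild hdiv hpol hW hWne hWs hnd htw
  obtain ⟨z, hz, b, hb, hne⟩ := hthick m U₁ hU₁W hU₁o hU₁ne
  exact absurd (hm z hz b hb) hne

end Summit.NavierStokesRegularity.NavierStokesRegularity.Cruxes.PoloidalWindowRigidity.KillingDoor
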